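import Literature.NumberTheory.Transcendental.L2HodgeTheoryHarmonicCoexactProofs
import HarnessLib

/-!
# Harmonic forms are `L²`-orthogonal to co-exact forms: corrected named fact (Warner, Thm. 6.8)

Companion of `Literature/NumberTheory/Transcendental/L2HodgeTheory.lean` (§*Orthogonality half
of the Hodge decomposition (Warner, Thm. 6.8) — deprecated records*) and
`Literature/NumberTheory/Transcendental/L2HodgeTheoryHarmonicCoexactProofs.lean` (the proofs).

The named fact `Literature.NumberTheory.Transcendental.isL2Orthogonal_harmonicForms_coexact`
("harmonic `k`-forms are `L²`-orthogonal to the co-exact forms `δγ`, `γ ∈ E^{k+1}(M)`", the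
orthogonality of the summands `δ(E^{p+1})` and `H^p` in F. W. Warner, *Foundations of
Differentiable Manifolds and Lie Groups*, GTM 94 (1983), Thm. 6.8, pp. 222–223,
`E^p(M) = d(E^{p-1}) ⊕ δ(E^{p+1}) ⊕ H^p`) was declared in `section Closed` of
`L2HodgeTheory.lean`, after `variable [CompactSpace M] [I.Boundaryless]
[IsContinuousRiemannianBundle E (TangentSpace I)] [IsContMDiffRiemannianBundle I ∞ E
(TangentSpace I)]`; these instance variables are not used in its body and hence — a `def`
abstracts only the section variables it mentions — are **not** hypotheses of the fact:
`#check @isL2Orthogonal_harmonicForms_coexact` lists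
`[T2Space M] [SigmaCompactSpace M] [IsManifold I ∞ M] [RiemannianBundle (TangentSpace I)] (o)
{k m}` only. It thus quantifies over non-compact manifolds, manifolds with boundary and fibre
metrics without regularity, whereas Warner's standing hypothesis is "`M` will be a compact
oriented Riemannian manifold" (p. 220; boundaryless, smooth metric), and in that generality it is
**false** — formally refuted twice: on the compact manifold with boundary `[0, 1]`
(`GreenCounterexample.not_isL2Orthogonal_harmonicForms_coexact_unitInterval` and
`not_forall_isL2Orthogonal_harmonicForms_coexact`, `L2HodgeTheoryBoundaryCounterexamples.lean`:
`1 = δ(-t dt)` is co-exact and harmonic, `⟪1, 1⟫ ≠ 0`), and on the boundaryless, non-compact flat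
real line (companion `L2HodgeTheoryHarmonicCoexactCounterexample.lean`, `FlatLine.…_real`: `1` is
harmonic, a bump `φ = δ d(-g)` with `g'' = φ`, `g` smooth but not compactly supported, is co-exact,
and `⟪1, φ⟫_{L²} = ∫_ℝ φ vol ≠ 0` for whichever partition of unity `MForm.integral` chose) — so
both of Warner's standing hypotheses are needed.

Following D-0014 / the provefact protocol the original def was not edited (no `_holds` can be
claimed for it). Since the verdict clean-up of `L2HodgeTheory.lean` (2026-08-15) it is a
deprecated record there: neither this file nor the proofs file names it, while the refutations of
the record *as literally declared* necessarily still have it in their types and are to be retired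
or restated together with its eventual deletion (see the record's docstring). This file vendors
the **corrected, closed statement**
`isL2Orthogonal_harmonicForms_coexact_of_closedManifold` — Warner's hypotheses
`[CompactSpace M] [I.Boundaryless] [IsContinuousRiemannianBundle E _]
[IsContMDiffRiemannianBundle I ∞ E _]` (with the ambient `[T2Space M] [IsManifold I ∞ M]`) bound
*inside* the statement — and discharges it by
`isL2Orthogonal_harmonicForms_coexact_of_isSmoothForm` of the proofs file (Warner's route:
`⟨η, δγ⟩ = ⟨dη, γ⟩ = 0` by Prop. 6.2 and Prop. 6.3, extended to spans by bilinearity), which is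
also the usable (open-hypothesis) form. The two witnesses above show that neither
`[CompactSpace M]` (flat-line witness `FlatLine.…_real`: `M = ℝ` is boundaryless and `σ`-compact
with a smooth metric and smooth volume form, but not compact) nor `[I.Boundaryless]` (the
`[0, 1]` witness) can be dropped from the statement below.

## References

* F. W. Warner, *Foundations of Differentiable Manifolds and Lie Groups*, GTM 94, Springer
  (1983): p. 220 (standing hypotheses, 6.1), Prop. 6.2–6.3 (pp. 220–221), Thm. 6.8
  (pp. 222–223).
-/

noncomputable section

open scoped Manifold ContDiff
open Bundle Module
open Literature.Geometry.Kaehler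

namespace Literature.NumberTheory.Transcendental

/-- **Corrected statement of the named fact
`Literature.NumberTheory.Transcendental.isL2Orthogonal_harmonicForms_coexact`** (now a deprecated
record of `L2HodgeTheory.lean`). On a compact oriented Riemannian manifold without boundary (Hausdorff,
`C^∞`, `C^∞` metric, orientation family `o` with smooth volume form), the space
`harmonicForms o h` of harmonic `k`-forms (`h : k + (m + 1) = n`) is `L²`-orthogonal to the span
of the co-exact forms `δγ`, `γ` a smooth `(k+1)`-form — the orthogonality of the summands
`δ(E^{p+1})` and `H^p` of the Hodge decomposition `E^p(M) = d(E^{p-1}) ⊕ δ(E^{p+1}) ⊕ H^p`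
(Warner (1983), Thm. 6.8, pp. 222–223; proof: `⟨η, δγ⟩ = ⟨dη, γ⟩ = 0` by Prop. 6.2 and 6.3).

Discrepancy with the original: `def isL2Orthogonal_harmonicForms_coexact` sits in a section whose
instance variables `[CompactSpace M] [I.Boundaryless] [IsContinuousRiemannianBundle E _]
[IsContMDiffRiemannianBundle I ∞ E _]` are not used in its body and are therefore not hypotheses
of the fact, which thus quantifies over non-compact manifolds, manifolds with boundary and
metrics of no regularity, and is false in that generality (formally refuted on `[0, 1]`,
`GreenCounterexample.not_isL2Orthogonal_harmonicForms_coexact_unitInterval`, and on the flat real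
line, `FlatLine.not_isL2Orthogonal_harmonicForms_coexact_real`), whereas Warner assumes `M`
compact (p. 220), boundaryless and the metric smooth. Here those hypotheses are binders *of the statement*; it is discharged by
`isL2Orthogonal_harmonicForms_coexact_of_closedManifold_holds`, and the usable form is
`Literature.NumberTheory.Transcendental.isL2Orthogonal_harmonicForms_coexact_of_isSmoothForm`.
[cite: WarnerGTM94, Thm. 6.8, pp. 222–223] -/
def isL2Orthogonal_harmonicForms_coexact_of_closedManifold : Prop :=
  ∀ {E : Type*} [NormedAddCommGroup E] [NormedSpace ℝ E] [FiniteDimensional ℝ E] {n : ℕ}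
    [Fact (finrank ℝ E = n)] [MeasurableSpace E] [BorelSpace E]
    {H : Type*} [TopologicalSpace H] {I : ModelWithCorners ℝ E H}
    {M : Type*} [TopologicalSpace M] [ChartedSpace H M] [T2Space M] [SigmaCompactSpace M]
    [IsManifold I ∞ M] [RiemannianBundle (fun x : M ↦ TangentSpace I x)]
    [CompactSpace M] [I.Boundaryless]
    [IsContinuousRiemannianBundle E (fun x : M ↦ TangentSpace I x)]
    [IsContMDiffRiemannianBundle I ∞ E (fun x : M ↦ TangentSpace I x)] {k m : ℕ}
    (o : (x : M) → Orientation ℝ (TangentSpace I x) (Fin n)),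
    IsSmoothForm (riemannianVolumeForm o) → ∀ h : k + (m + 1) = n,
      IsL2Orthogonal o (harmonicForms o h : Set (MForm I M ℝ k))
        (Submodule.span ℝ (mcoderiv o (show (k + 1) + m = n by omega) ''
          (smoothForms I M ℝ (k + 1) : Set (MForm I M ℝ (k + 1)))))

/-- **Discharge** of `isL2Orthogonal_harmonicForms_coexact_of_closedManifold` (the corrected form
of the named fact `isL2Orthogonal_harmonicForms_coexact`): immediate from
`isL2Orthogonal_harmonicForms_coexact_of_isSmoothForm` (`⟨η, δγ⟩ = ⟨dη, γ⟩ = 0`, Warner's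
Prop. 6.2 via Stokes and Prop. 6.3, then bilinearity). Warner (1983), Thm. 6.8, pp. 222–223.
[cite: WarnerGTM94, Thm. 6.8, pp. 222–223] -/
theorem isL2Orthogonal_harmonicForms_coexact_of_closedManifold_holds :
    isL2Orthogonal_harmonicForms_coexact_of_closedManifold :=
  fun o ho h ↦ isL2Orthogonal_harmonicForms_coexact_of_isSmoothForm o ho h

end Literature.NumberTheory.Transcendental
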